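import Summits.QuantumFields.BalabanUV.T4Continuum.Spine.NE3.FrameNormalisationOneLevel
import HarnessLib

/-!
# T⁴ programme, node NE3 — census R50 open half (M1), FIFTH BRICK: the twisted tower EXISTS for every gauge — so the frame condition of an ARBITRARY gauge `v` IS the fixed-point
# equation `v(L^kz) = u₀(L^kz)⁻¹ · 𝔳_k[v](z)` on its top corner data, unconditionally (`FrameNormalisationTowerExists`)

Cell `pub-balaban-gaps` (track G2, seat ne3, generation 11), row NE3; census `HOME/ne/NE3.md` §4 R50, §17 (M1).  `FrameNormalisationTower.tower_mgauge_general` ∕ `frameCondition_iff_topData`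
take the twisted block frames `w′ʲ`, the twisted double-bar tower `Dʲ` and the twisted accumulated frame `𝔳_j` as HYPOTHESES on three sequences.  This module discharges them: for
every background `W`, start-frame perturbation `U′` and gauge `v` the three sequences EXIST (built by recursion on the level inside the proof — no definition is added to the tree),
with `w′ʲ` IDENTIFIED as the `δ`-twisted frames of `FrameNormalisationDefect` (`w′ʲ(y) = exp Σ_r L^{−d} log[(R_{Ū₀ʲ,y}Dʲ)(Γ_{y,y+r})·δ_{v_j}(y,Γ_{y,y+r})⁻¹]`,
`δ_{v_j}(y,Γ) = v_j(y)⁻¹·R(Ū₀ʲ(Γ))v_j(y+r)`), so that the size bricks (`FrameNormalisationDefectSize`, `FrameNormalisationOscillation`) apply to them level by level: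

* **`exists_twistedTower`** — `∃ D w′ 𝔳` with `D⁰ = U′`, `𝔳₀ = 1`, the frame covariance `w[Ū₀ʲ]((Dʲ)^{v_j})(y) = R(v_j(y)) w′ʲ(y)` (the general covariance of (82), re-derived inline from
  (58)∕(93) `tHol_mgauge` and (57) `mlog_Rc` ∕ `expUnit_conj`), the recursions `D^{j+1}(z,κ) = w′ʲ(Lz)⁻¹·Ṽ[Ū₀ʲ,Dʲ](Lz,κ)·R(\overline{Ū₀ʲ}(Lz,κ))w′ʲ(Lz+Le_κ)`,
  `𝔳_{j+1}(z) = 𝔳_j(Lz)·w′ʲ(Lz)`, and the identification of `w′ʲ` as the `δ`-twisted frames.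

Consequently (with `FrameNormalisationTower`): for EVERY gauge `v`, `(U′^{v})̿ʲ = (Dʲ)^{v_j}`, `v_j(U′^{v}) = R(v_j)𝔳_j`, and the frame condition ⟺ `v(L^kz) = u₀(L^kz)⁻¹·𝔳_k(z)`.

HONEST FRAMING (page 1).  Group algebra on the tree's formal objects (0 def, 0 sorry); the contraction of (M1) (smooth corner interpolant, jointly with (1.38)) is NOT done; nothing
of Bałaban's asserted; **NE3 NOT proved**; `PairLandauGaugeB8Avg` and the covariant root NOT proved; spine PROVED 0∕9; finite T⁴ rung (B)+1 — NOT continuum YM on ℝ⁴, NOT infinite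
volume, NOT mass gap, NOT `BetaPertH`, NOT Clay.  HONEST DEPENDENCY: continuum YM on T⁴ ⇐ BetaPertH ∧ nine spine estimates (0/9 proved); BetaPertH ⇐ (D1) ∧ (D4) ∧ CAP+tail;
G-an2-4 gates asym, D1 and NE2/3/4.  PLACEMENT: `Summits/QuantumFields/BalabanUV/T4Continuum/Spine/NE3/`; imports `FrameNormalisationOneLevel` only.

References: [Balaban1985Averaging] T. Bałaban, *Averaging operations for lattice gauge theories*, CMP 98 (1985) 17–51: (57)–(59) p. 27, (62) p. 28, (82) p. 30, (89)–(93)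
pp. 31–32, (96)–(99) p. 32.
-/

set_option autoImplicit false

open scoped BigOperators Matrix Matrix.Norms.L2Operator
open NormedSpace

namespace Summit.QuantumFields.BalabanUV.T4Continuum.NE3.FrameNormalisationTowerExists

open Literature.MathematicalPhysics.QuantumFieldTheory.Balaban1983to89
open B7Prop1Explicit B7Prop2Explicit MatrixLog
open B7AvgGaugeCovariance (uLev)
open B7Eq92Concrete (Rc Rc_apply mgauge tHol tHol_mgauge Fcov wframe tild mlog_Rc expUnit_conj)

noncomputable section

variable {d : ℕ} {n : Type*} [Fintype n] [DecidableEq n]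

/-- **THE TWISTED TOWER EXISTS FOR EVERY GAUGE** (recursion on the level; `w′ʲ` = the `δ`-twisted block frames of `Dʲ` at the background `Ū₀ʲ` for the corner values `v_j`).
The hypotheses of `FrameNormalisationTower.tower_mgauge_general` ∕ `frameCondition_iff_topData`, discharged. [folklore] -/
theorem exists_twistedTower (L : ℕ) (W U' : Site d → Fin d → (Matrix n n ℂ)ˣ) (v : Site d → (Matrix n n ℂ)ˣ) :
    ∃ (D : ℕ → Site d → Fin d → (Matrix n n ℂ)ˣ) (w' 𝔳 : ℕ → Site d → (Matrix n n ℂ)ˣ),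
      D 0 = U' ∧ (∀ z : Site d, 𝔳 0 z = 1) ∧
      (∀ (j : ℕ) (y : Site d), wframe L (avgIter L W j) (mgauge (avgIter L W j) (uLev L v j) (D j)) y = Rc (uLev L v j y) (w' j y)) ∧
      (∀ (j : ℕ) (z : Site d) (κ : Fin d), D (j + 1) z κ
        = (w' j ((L : ℤ) • z))⁻¹ * tild L (avgIter L W j) (D j) ((L : ℤ) • z) κ
            * Rc (bavg L (avgIter L W j) ((L : ℤ) • z) κ) (w' j ((L : ℤ) • z + (L : ℤ) • e κ))) ∧
      (∀ (j : ℕ) (z : Site d), 𝔳 (j + 1) z = 𝔳 j ((L : ℤ) • z) * w' j ((L : ℤ) • z)) ∧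
      (∀ (j : ℕ) (y : Site d), w' j y
        = expUnit (∑ r : Fin d → Fin L, (((L : ℝ) ^ d)⁻¹) •
            mlog ((tHol (avgIter L W j) (D j) y (treeWord (boxVec L r)) *
              ((uLev L v j y)⁻¹ * Rc (hol (avgIter L W j) y (treeWord (boxVec L r))) (uLev L v j (y + boxVec L r)))⁻¹ :
                (Matrix n n ℂ)ˣ) : Matrix n n ℂ))) := by
  -- the general covariance of the block frame (82): `w[V₀](X^{u})(y) = R(u(y)) · exp Σ_r L^{−d} log[(R_{V₀,y}X)(Γ_r)·δ_u(y,Γ_r)⁻¹]`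
  have hF : ∀ (V₀ X : Site d → Fin d → (Matrix n n ℂ)ˣ) (u : Site d → (Matrix n n ℂ)ˣ) (y : Site d),
      wframe L V₀ (mgauge V₀ u X) y
        = Rc (u y) (expUnit (∑ r : Fin d → Fin L, (((L : ℝ) ^ d)⁻¹) •
            mlog ((tHol V₀ X y (treeWord (boxVec L r)) *
              ((u y)⁻¹ * Rc (hol V₀ y (treeWord (boxVec L r))) (u (y + boxVec L r)))⁻¹ : (Matrix n n ℂ)ˣ) : Matrix n n ℂ))) := by
    intro V₀ X u y
    have h1 : ∀ w : List (Letter d),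
        tHol V₀ (mgauge V₀ u X) y w = Rc (u y) (tHol V₀ X y w * ((u y)⁻¹ * Rc (hol V₀ y w) (u (y + disp w)))⁻¹) := by
      intro w
      rw [tHol_mgauge]
      simp only [Rc_apply, mul_inv_rev, inv_inv]
      group
    have h2 : Fcov L V₀ (mgauge V₀ u X) y
        = (u y : Matrix n n ℂ) *
            (∑ r : Fin d → Fin L, (((L : ℝ) ^ d)⁻¹) •
              mlog ((tHol V₀ X y (treeWord (boxVec L r)) *
                ((u y)⁻¹ * Rc (hol V₀ y (treeWord (boxVec L r))) (u (y + boxVec L r)))⁻¹ : (Matrix n n ℂ)ˣ) : Matrix n n ℂ)) *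
            ((u y)⁻¹ : (Matrix n n ℂ)ˣ) := by
      unfold Fcov
      rw [Finset.mul_sum, Finset.sum_mul]
      refine Finset.sum_congr rfl fun r _ => ?_
      rw [h1, disp_treeWord, mlog_Rc, ← smul_mul_assoc, ← mul_smul_comm]
    unfold wframe
    rw [h2, expUnit_conj]
  -- the twisted frame functional, the tower and the accumulated frame, by recursion on the level
  let wδ : ℕ → (Site d → Fin d → (Matrix n n ℂ)ˣ) → Site d → (Matrix n n ℂ)ˣ := fun j X y =>
    expUnit (∑ r : Fin d → Fin L, (((L : ℝ) ^ d)⁻¹) •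
      mlog ((tHol (avgIter L W j) X y (treeWord (boxVec L r)) *
        ((uLev L v j y)⁻¹ * Rc (hol (avgIter L W j) y (treeWord (boxVec L r))) (uLev L v j (y + boxVec L r)))⁻¹ : (Matrix n n ℂ)ˣ) : Matrix n n ℂ))
  let D : ℕ → Site d → Fin d → (Matrix n n ℂ)ˣ := fun j =>
    Nat.rec (motive := fun _ => Site d → Fin d → (Matrix n n ℂ)ˣ) U'
      (fun i X => fun z κ => (wδ i X ((L : ℤ) • z))⁻¹ * tild L (avgIter L W i) X ((L : ℤ) • z) κ
        * Rc (bavg L (avgIter L W i) ((L : ℤ) • z) κ) (wδ i X ((L : ℤ) • z + (L : ℤ) • e κ))) j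
  let 𝔳 : ℕ → Site d → (Matrix n n ℂ)ˣ := fun j =>
    Nat.rec (motive := fun _ => Site d → (Matrix n n ℂ)ˣ) (fun _ => 1) (fun i V => fun z => V ((L : ℤ) • z) * wδ i (D i) ((L : ℤ) • z)) j
  refine ⟨D, fun j => wδ j (D j), 𝔳, rfl, fun z => rfl, fun j y => hF (avgIter L W j) (D j) (uLev L v j) y, fun j z κ => rfl,
    fun j z => rfl, fun j y => rfl⟩

end

end Summit.QuantumFields.BalabanUV.T4Continuum.NE3.FrameNormalisationTowerExists
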